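import Summits.Ventures.YMGap.Census.PotentialMovingStrict
import Summits.Ventures.YMGap.Census.Decimation
import Summits.Ventures.YMGap.Census.DecimationAntitoneR
import Summits.Ventures.YMGap.Census.InterpolationAlpha
import Summits.Ventures.YMGap.Census.InterpolationAlphaPlus
import Summits.Ventures.YMGap.Census.DecimationTwistPlus
import Summits.Ventures.YMGap.Census.TorusZNontrivial
import Summits.Ventures.YMGap.Census.DecimationNontrivial
import HarnessLib

/-!
# Venture YMGap, track (b) — STRICT Prop. III.1 / IV.3 and the EXISTENCE of Tomboulis's interpolation parameters
# `α_Λ(t, r)`, `α⁺_Λ(t, r)` in the OPEN interval `(0, 1)` (arXiv:0707.2179 §3.2 (3.23)–(3.24), §4 (4.18)–(4.19))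

HONEST FRAMING: venture file of the cell `pub-ymgap` (QuantumFields programme), track (b) census.  Exact statements about
ONE decimation `(ℤ/bLℤ)^d → (ℤ/Lℤ)^d`, `d ≥ 3`, `b ≥ 2`, on the positivity domain `f_c ≥ 0`; nothing about (5.15)/(5.16),
Ito–Seiler's Problem 2 (a COMMON `α` for `Z` and `Z⁺` — `Tomboulis2007.ISProblem2`, untouched), limits, confinement or a
mass gap.

Tomboulis (§3.2, after (3.22)): «It follows from (3.22) that there exist a value of `α` in `(0,1)` … such that
`Z̃_{Λ^{(m)}}(β, h, α_{Λ,h}^{(m)}(t,r), t, r) = Z_{Λ^{(m-1)}}`» — the upper end of (3.22) is Prop. III.1, and `α < 1` needs it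
STRICT («equality only in the trivial case where all `c_j` vanish», printed for II.1/III.2/IV.2/IV.4 and used for III.1).
The tree had the existence up to the endpoint (`InterpolationAlpha.exists_alpha_Ioc`, `α ∈ (0,1]`) and the open-interval
form from any strict III.1 instance (`exists_isAlpha_of_lt`).  With `PotentialMovingStrict.torusZ_fine_lt_powFieldZ_mkExp`:
* `powFieldZ_mkExp_eq_decimated` — the exact integrations of `Decimation.lean`, isolated:
  `Z(e_MK) = F₀^U(1)^{|Λ^{(1)}|} · Z_{(ℤ/L)^d}({c^U_j(1,1)})`;
* **`decimationUpperBound_strict_of_nonneg`** — STRICT III.1 (3.4) at `r = 1`: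
  `Z_{(ℤ/bL)^d}({c_j}) < F₀^U(1)^{|Λ^{(1)}|} · Z_{(ℤ/L)^d}({c^U_j(1,1)})` for `d ≥ 3`, `b ≥ 2`, every `L ≥ 1`, `J`, admissible `c`
  with `f_c ≥ 0` and some `c_n > 0`; `…_of_le_one` — the same for `0 ≤ r ≤ 1` on even coarse tori (`DecimationAntitoneR`);
* **`exists_isAlpha`** — `∃ α, IsAlpha d L b J r c t α` (`α ∈ (0,1)`, `Z̃(α,t) = Z_Λ`) for `d ≥ 3`, `b ≥ 2`, `L` even, every
  `J`, `0 ≤ r ≤ 1`, `t > 0`, admissible `c` with `f_c ≥ 0` and some `c_n > 0` — (3.23)–(3.24) AS PRINTED at the first step;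
* **`decimationUpperBoundPlus_strict_of_nonneg`** (`…_of_le_one`) — STRICT IV.3 (4.12) (strict III.1 + the twisted bound
  (UAtwist) `DecimationTwist`, `Z⁺ = (Z + Z⁻)/2`), every plane; **`exists_isAlphaPlus`** — `∃ α, IsAlphaPlus L b J r i j hij c t α`
  ((4.18)–(4.19) at the first step).
* **`exists_isAlpha_iter`** — `α` exists in `(0,1)` at EVERY scale `m` of the `r = 1` flow `c^U(m)` of `DecimationIterated`
  (non-triviality survives the step: `DecimationNontrivial.iterCoeff_pos_of_pos`);
* **`existsUnique_isAlpha`** / **`existsUnique_isAlphaPlus`** — existence AND uniqueness («This value is unique by III.3»), with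
  `DecimationNontrivial.isAlpha_unique` / `isAlphaPlus_unique` (III.3 / IV.5 strict for `t > 0`).
NOT CLAIMED: `d = 2` (there `α ≡ 1`: `TwoDimDecimation.not_commonInterpolation_two`), odd coarse tori for `r < 1`, the flow at
`r < 1` (positivity of `f` for real powers `ĉ^{b²r}` is not in the tree), `t = 0`, anything about `α_Λ(t) = α⁺_Λ(t)`.

References: E. T. Tomboulis, arXiv:0707.2179, §3.2 eqs. (3.22)–(3.24), Props. III.1, III.3, IV.3, IV.5, App. A §4
[cite: Tomboulis2007Confinement, §3.2 eqs. (3.23)–(3.24)]; K. R. Ito, E. Seiler, arXiv:0711.4930, §2 (2.4)–(2.6), §3 (3.1)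
[cite: ItoSeiler2007Tomboulis, §2 eq. (2.4)].
-/

noncomputable section

open MeasureTheory Finset Real Function
open scoped BigOperators
open Literature.MathematicalPhysics.QuantumLattice
open Literature.MathematicalPhysics.QuantumFieldTheory
open Literature.MathematicalPhysics.QuantumFieldTheory.Tomboulis2007
open Literature.MathematicalPhysics.QuantumFieldTheory.WilsonRP
open Summit.Ventures.LatticeQCDFlow.Exactness
open Summit.Ventures.LatticeQCDFlow.Scoring

namespace Summit.Ventures.YMGap.Census

variable {d L : ℕ}

/-! ### STRICT III.1 / IV.3 and the existence of `α_Λ(t, r)`, `α⁺_Λ(t, r)` in the OPEN interval -/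

section StrictDecimation

variable {b : ℕ} [NeZero b] [NeZero L]

/-- **The exact integrations** (arXiv:0707.2179 App. A §4, (A.19)): the completely moved partition function IS the
decimated one, `Z(e_MK) = F₀^U(1)^{|Λ^{(1)}|} · Z_{(ℤ/L)^d}({c^U_j(1,1)})` (the equality half of `Decimation.lean`,
isolated). -/
theorem powFieldZ_mkExp_eq_decimated (J : ℕ) {c : ℕ → ℝ} (hc : ∀ n, 1 ≤ n → 0 ≤ c n) :
    powFieldZ J c (fun p : Plaquette d (b * L) => if ∀ κ ∈ perpDirs p, resb b L (p.1 κ) = 0 then b ^ (d - 2) else 0) =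
      mkF0 J c (b ^ (d - 2)) b ^ Fintype.card (Plaquette d L) *
        torusZ d L (b ^ (d - 2) * J) (mkCoeff J c (b ^ (d - 2)) b 1) := by
  rw [powFieldZ_mkExp_eq J hc (b ^ (d - 2)), integral_windowFn_eq_prod_mergedFace]
  have hG : ∀ W : GaugeConfig d (b * L) SU2, ∏ P : Plaquette d L,
      mergedFace b (b ^ (d - 2) * J) (stdCoef (hatCoeff J c (b ^ (d - 2)))) P W =
      torusFn (b ^ (d - 2) * J) (stdCoef (mkCoeff J c (b ^ (d - 2)) b 1)) (cwConfig b W) := by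
    intro W
    have hco : mkCoeff J c (b ^ (d - 2)) b 1 = fun n => hatCoeff J c (b ^ (d - 2)) n ^ (b ^ 2) :=
      funext fun n => mkCoeff_one_eq_pow J c _ b n
    rw [hco, ← cellCoef_stdCoef]
    unfold torusFn mergedFace
    simp only [coarseWord_eq_holonomy]
  simp_rw [hG]
  rw [integral_comp_cwConfig (continuous_torusFn _ _), integral_torusFn_stdCoef]
  unfold mkF0
  rw [← pow_mul, mul_comm (b ^ 2)]

/-- **STRICT Prop. III.1 at `r = 1`** (arXiv:0707.2179 (3.4) with the printed «equality only in the trivial case»):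
for `d ≥ 3`, `b ≥ 2`, every `L ≥ 1`, `J`, admissible `c` with `f_c ≥ 0` and some `c_n > 0`,
`Z_{(ℤ/bL)^d}({c_j}) < F₀^U(1)^{|Λ^{(1)}|} · Z_{(ℤ/L)^d}({c^U_j(1,1)})`. -/
theorem decimationUpperBound_strict_of_nonneg (hd : 3 ≤ d) (hb : 2 ≤ b) (J : ℕ) {c : ℕ → ℝ} (hc : CoeffAdmissible c)
    (hf : ∀ g : SU2, 0 ≤ plaqFn J c g) {n₀ : ℕ} (hn₀ : n₀ ∈ Icc 1 J) (hpos : 0 < c n₀) :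
    torusZ d (b * L) J c <
      mkF0 J c (b ^ (d - 2)) b ^ Fintype.card (Plaquette d L) *
        torusZ d L (b ^ (d - 2) * J) (mkCoeff J c (b ^ (d - 2)) b 1) := by
  have hc' : ∀ n, 1 ≤ n → 0 ≤ c n := fun n hn => (hc n hn).1
  rw [← powFieldZ_mkExp_eq_decimated J hc']
  exact torusZ_fine_lt_powFieldZ_mkExp b hd hb J hc' hf hn₀ hpos

/-- **STRICT Prop. III.1 for every `0 ≤ r ≤ 1`** on an even coarse torus (the right-hand side is non-increasing in `r`,
`DecimationAntitoneR`). -/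
theorem decimationUpperBound_strict_of_nonneg_of_le_one (hd : 3 ≤ d) (hb : 2 ≤ b) (hL : Even L) (J : ℕ) {c : ℕ → ℝ}
    (hc : CoeffAdmissible c) (hf : ∀ g : SU2, 0 ≤ plaqFn J c g) {n₀ : ℕ} (hn₀ : n₀ ∈ Icc 1 J) (hpos : 0 < c n₀) {r : ℝ}
    (hr0 : 0 ≤ r) (hr1 : r ≤ 1) :
    torusZ d (b * L) J c <
      mkF0 J c (b ^ (d - 2)) b ^ Fintype.card (Plaquette d L) *
        torusZ d L (b ^ (d - 2) * J) (mkCoeff J c (b ^ (d - 2)) b r) := by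
  haveI : NeZero d := ⟨by omega⟩
  have hc' : ∀ n, 1 ≤ n → 0 ≤ c n := fun n hn => (hc n hn).1
  refine (decimationUpperBound_strict_of_nonneg hd hb J hc hf hn₀ hpos).trans_le ?_
  exact decimationRhs_antitoneOn (b := b) hL J hc' hf (b ^ (d - 2)) (Set.mem_Ici.2 hr0)
    (Set.mem_Ici.2 (zero_le_one : (0 : ℝ) ≤ 1)) hr1

/-- **Existence of Tomboulis's interpolation parameter `α_Λ(t, r) ∈ (0, 1)` — arXiv:0707.2179 §3.2, (3.23)–(3.24)
AS PRINTED («there exist a value of α in (0,1) … such that Z̃(α) = Z_{Λ^{(m-1)}}»)** — at the first decimation step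
`(ℤ/bL)^d → (ℤ/L)^d`: for `d ≥ 3`, `b ≥ 2`, `L` even, every `J`, every `0 ≤ r ≤ 1` and `t > 0`, and every admissible
`c` on the positivity domain `f_c ≥ 0` with some `c_n > 0`, the tree's defining relation `IsAlpha d L b J r c t α`
(`α ∈ (0,1)` open, `Z̃(α, t) = Z_Λ`) has a solution. -/
theorem exists_isAlpha (hd : 3 ≤ d) (hb : 2 ≤ b) (hL : Even L) (J : ℕ) {c : ℕ → ℝ} (hc : CoeffAdmissible c)
    (hf : ∀ g : SU2, 0 ≤ plaqFn J c g) {n₀ : ℕ} (hn₀ : n₀ ∈ Icc 1 J) (hpos : 0 < c n₀) {r : ℝ} (hr0 : 0 ≤ r) (hr1 : r ≤ 1)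
    {t : ℝ} (ht : 0 < t) : ∃ α : ℝ, IsAlpha d L b J r c t α := by
  have hZ : 1 < torusZ d (b * L) J c := one_lt_torusZ_of_pos hd (hL.mul_left b) J hc hn₀ hpos
  refine exists_isAlpha_of_lt hd hL J hc hf hZ hr0 hr1 ht ?_
  rw [tildeZ_one]
  exact decimationUpperBound_strict_of_nonneg_of_le_one hd hb hL J hc hf hn₀ hpos hr0 hr1

/-- **STRICT Prop. IV.3 at `r = 1`** (arXiv:0707.2179 (4.12), `Z⁺ = (Z + Z⁻)/2`): strict III.1 plus the (non-strict)
twisted bound (UAtwist), for `d ≥ 3`, `b ≥ 2`, coarse side `L ≥ 2`, every plane. -/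
theorem decimationUpperBoundPlus_strict_of_nonneg [Fact (1 < L)] (hd : 3 ≤ d) (hb : 2 ≤ b) {i j : Fin d} (hij : i < j)
    (J : ℕ) {c : ℕ → ℝ} (hc : CoeffAdmissible c) (hf : ∀ g : SU2, 0 ≤ plaqFn J c g) {n₀ : ℕ} (hn₀ : n₀ ∈ Icc 1 J)
    (hpos : 0 < c n₀) :
    torusZplus d (b * L) J c (vortexSheet (b * L) i j hij) <
      mkF0 J c (b ^ (d - 2)) b ^ Fintype.card (Plaquette d L) *
        torusZplus d L (b ^ (d - 2) * J) (mkCoeff J c (b ^ (d - 2)) b 1) (vortexSheet L i j hij) := by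
  have h1 := decimationUpperBound_strict_of_nonneg (L := L) hd hb J hc hf hn₀ hpos
  have h2 := twistedDecimationUpperBound_of_nonneg (d := d) (L := L) (b := b) hij J hc hf
  unfold torusZplus
  rw [mul_div_assoc', mul_add]
  linarith

/-- **STRICT Prop. IV.3 for every `0 ≤ r ≤ 1`** on an even coarse torus, every plane. -/
theorem decimationUpperBoundPlus_strict_of_nonneg_of_le_one (hd : 3 ≤ d) (hb : 2 ≤ b) (hL : Even L) {i j : Fin d}
    (hij : i < j) (J : ℕ) {c : ℕ → ℝ} (hc : CoeffAdmissible c) (hf : ∀ g : SU2, 0 ≤ plaqFn J c g) {n₀ : ℕ}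
    (hn₀ : n₀ ∈ Icc 1 J) (hpos : 0 < c n₀) {r : ℝ} (hr0 : 0 ≤ r) (hr1 : r ≤ 1) :
    torusZplus d (b * L) J c (vortexSheet (b * L) i j hij) <
      mkF0 J c (b ^ (d - 2)) b ^ Fintype.card (Plaquette d L) *
        torusZplus d L (b ^ (d - 2) * J) (mkCoeff J c (b ^ (d - 2)) b r) (vortexSheet L i j hij) := by
  haveI : Fact (1 < L) := ⟨by obtain ⟨k, hk⟩ := hL; have := NeZero.ne L; omega⟩
  have hc' : ∀ n, 1 ≤ n → 0 ≤ c n := fun n hn => (hc n hn).1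
  refine (decimationUpperBoundPlus_strict_of_nonneg hd hb hij J hc hf hn₀ hpos).trans_le ?_
  exact decimationRhsPlus_antitoneOn (b := b) hL J hij hc' hf (b ^ (d - 2)) (Set.mem_Ici.2 hr0)
    (Set.mem_Ici.2 (zero_le_one : (0 : ℝ) ≤ 1)) hr1

/-- **Existence of `α⁺_Λ(t, r) ∈ (0, 1)` — arXiv:0707.2179 (4.18)–(4.19) at the first step**: for `d ≥ 3`, `b ≥ 2`,
`L` even, every plane `(i, j)`, `J`, `0 ≤ r ≤ 1`, `t > 0`, admissible `c` with `f_c ≥ 0` and some `c_n > 0`, the tree's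
`IsAlphaPlus L b J r i j hij c t α` has a solution. -/
theorem exists_isAlphaPlus (hd : 3 ≤ d) (hb : 2 ≤ b) (hL : Even L) {i j : Fin d} (hij : i < j) (J : ℕ) {c : ℕ → ℝ}
    (hc : CoeffAdmissible c) (hf : ∀ g : SU2, 0 ≤ plaqFn J c g) {n₀ : ℕ} (hn₀ : n₀ ∈ Icc 1 J) (hpos : 0 < c n₀) {r : ℝ}
    (hr0 : 0 ≤ r) (hr1 : r ≤ 1) {t : ℝ} (ht : 0 < t) : ∃ α : ℝ, IsAlphaPlus L b J r i j hij c t α := by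
  have hZ : 1 < torusZplus d (b * L) J c (vortexSheet (b * L) i j hij) :=
    one_lt_torusZplus_of_pos hd (hL.mul_left b) J hij hc hn₀ hpos
  refine exists_isAlphaPlus_of_lt hL J hij hc hf hZ hr0 hr1 ht ?_
  rw [tildeZplus_one]
  exact decimationUpperBoundPlus_strict_of_nonneg_of_le_one hd hb hL hij J hc hf hn₀ hpos hr0 hr1

end StrictDecimation

/-! ### `α` at every scale of the `r = 1` flow; existence AND uniqueness -/

section Flow

variable {b : ℕ} [NeZero b] [NeZero L]

/-- **`α_Λ(t, r) ∈ (0,1)` exists at EVERY scale of the `r = 1` Migdal–Kadanoff flow**: for every `m`, the decimation step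
`(ℤ/bL)^d → (ℤ/L)^d` started from the `m`-times decimated coefficients `c^U(m)` (cut-off `b^{(d-2)m} J`, `DecimationIterated`) has an
interpolation parameter in the open interval (`d ≥ 3`, `b ≥ 2`, `L` even, `0 ≤ r ≤ 1`, `t > 0`; positivity and non-triviality are
inherited: `iterCoeff_admissible_nonneg`, `DecimationNontrivial.iterCoeff_pos_of_pos`). -/
theorem exists_isAlpha_iter (hd : 3 ≤ d) (hb : 2 ≤ b) (hL : Even L) (J : ℕ) {c : ℕ → ℝ} (hc : CoeffAdmissible c)
    (hf : ∀ g : SU2, 0 ≤ plaqFn J c g) {n₀ : ℕ} (hn₀ : n₀ ∈ Icc 1 J) (hpos : 0 < c n₀) {r : ℝ} (hr0 : 0 ≤ r) (hr1 : r ≤ 1)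
    {t : ℝ} (ht : 0 < t) (m : ℕ) : ∃ α : ℝ, IsAlpha d L b (iterJ b d J m) r (iterCoeff b d J c m) t α := by
  have hstep := iterCoeff_admissible_nonneg (b := b) (d := d) J hc hf m
  have hnz := iterCoeff_pos_of_pos (b := b) (d := d) J hc hf hn₀ hpos m
  exact exists_isAlpha hd hb hL _ hstep.1 hstep.2 hnz.1 hnz.2 hr0 hr1 ht

/-- **`α_Λ(t, r)` exists and is unique — arXiv:0707.2179 (3.23)–(3.24) with «This value is unique by III.3»** (first step; `d ≥ 3`,
`b ≥ 2`, `L` even, `0 ≤ r ≤ 1`, `t > 0`, admissible `c` on the positivity domain with some `c_n > 0`). -/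
theorem existsUnique_isAlpha (hd : 3 ≤ d) (hb : 2 ≤ b) (hL : Even L) (J : ℕ) {c : ℕ → ℝ} (hc : CoeffAdmissible c)
    (hf : ∀ g : SU2, 0 ≤ plaqFn J c g) {n₀ : ℕ} (hn₀ : n₀ ∈ Icc 1 J) (hpos : 0 < c n₀) {r : ℝ} (hr0 : 0 ≤ r) (hr1 : r ≤ 1)
    {t : ℝ} (ht : 0 < t) : ∃! α : ℝ, IsAlpha d L b J r c t α := by
  obtain ⟨α, hα⟩ := exists_isAlpha hd hb hL J hc hf hn₀ hpos hr0 hr1 ht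
  have hc' : ∀ n, 1 ≤ n → 0 ≤ c n := fun n hn => (hc n hn).1
  exact ⟨α, hα, fun α' hα' => isAlpha_unique hd hb hL J hc' hf hn₀ hpos hr0 ht hα' hα⟩

/-- **`α⁺_Λ(t, r)` exists and is unique — arXiv:0707.2179 (4.18)–(4.19) with IV.5** (first step, every plane; hypotheses as above). -/
theorem existsUnique_isAlphaPlus (hd : 3 ≤ d) (hb : 2 ≤ b) (hL : Even L) {i j : Fin d} (hij : i < j) (J : ℕ) {c : ℕ → ℝ}
    (hc : CoeffAdmissible c) (hf : ∀ g : SU2, 0 ≤ plaqFn J c g) {n₀ : ℕ} (hn₀ : n₀ ∈ Icc 1 J) (hpos : 0 < c n₀) {r : ℝ}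
    (hr0 : 0 ≤ r) (hr1 : r ≤ 1) {t : ℝ} (ht : 0 < t) : ∃! α : ℝ, IsAlphaPlus L b J r i j hij c t α := by
  obtain ⟨α, hα⟩ := exists_isAlphaPlus hd hb hL hij J hc hf hn₀ hpos hr0 hr1 ht
  have hc' : ∀ n, 1 ≤ n → 0 ≤ c n := fun n hn => (hc n hn).1
  exact ⟨α, hα, fun α' hα' => isAlphaPlus_unique hd hb hL J hij hc' hf hn₀ hpos hr0 ht hα' hα⟩

end Flow

end Summit.Ventures.YMGap.Census

end
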